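import Summits.CriticalPhenomena.PercolationContinuityZ3.Theorems.Transplant.FKConnectivityAllQPat3KNetSPBridgePcD1
import HarnessLib

/-!
# Connectivity correlation inequalities for `φ_{w,q}`, every `q > 0` — THEOREM SP(𝒦), three inner marks (`pc`), the BRIDGE side: dispatch (part 2)

Helper file (`--supports stmt-CriticalPhenomena-4575`), census lineage (gen 41) of LANE 2's FK sub-programme; builds on p205010 (kernel
theorem, internal audit signed; external expert review pending).  No definitions, no named facts, no sorries; standard axioms.

The position dispatch of the `pc` bridge branch of THEOREM SP(𝒦) (census g41 drafts/README; sub-case lemmas in «Pat3KNetSPBridgePc»;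
generated mechanically from the case table, every position reduced to a canonical one by `FK.BridgeSep.swap_cd / symm` and the `SPGoodC`
symmetries).  The K-state leaves enter as hypotheses: `hTri3` (marks in `cd, xc, xd`), `hClaw3` (`cd, xc, yc`), `hPathA` (`xc, xd, yc`),
`hPathB` (`cd, xc, yd`), `hVee3` (corner `c`, slots `xd, yd`).  `FK.pcK_bridge_dispatch` is the whole `| bridge` alternative of `FK.pcK_good`.
[cite: AyyerLinussonRavichandran2025, §7 (p. 22)]
-/

namespace Summit.CriticalPhenomena.PercolationContinuityZ3.Theorems

namespace FK

open SimpleGraph Literature.Probability.LatticeModels Literature.Probability.Percolation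
open scoped Classical

variable {V : Type*}

section PcDispatch

variable [Fintype V] {n : ℕ} {N₀ : Finset (Sym2 V)} {Qac Qad Qbc Qbd Qcd E₂ E C : Finset (Sym2 V)} {x y c d b s t : V}

omit [Fintype V] in
/-- `pc`, bridge side, `b` interior to the slot `cd`, `s, t` interior to slots: 25 positions. [cite: AyyerLinussonRavichandran2025, §7 (p. 22)] -/
theorem pcK_bridge_b_in_cd
    (hTypeI : ∀ {E₁ E₂ E C : Finset (Sym2 V)} {x y b s t : V},
      IsKNet E₁ x y → IsKNet E₂ x y → Disjoint E₁ E₂ → E₁ ∪ E₂ ⊆ N₀ →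
      (∀ z : V, (∃ e ∈ E₁, z ∈ e) → (∃ e ∈ E₂, z ∈ e) → z = x ∨ z = y) →
      E ⊆ E₁ ∪ E₂ → C ⊆ E₁ ∪ E₂ →
      (∃ e ∈ E₁, s ∈ e) → (∃ e ∈ E₁, t ∈ e) → (∃ e ∈ E₂, b ∈ e) →
      s ≠ x → s ≠ y → t ≠ x → t ≠ y → b ≠ x → b ≠ y → s ≠ t → SPGoodC E C b s t)
    (ih : ∀ {E₁ E₂ E C : Finset (Sym2 V)} {x y b s t : V}, E₁.card ≤ n →
      IsKNet E₁ x y → IsKNet E₂ x y → Disjoint E₁ E₂ → E₁ ∪ E₂ ⊆ N₀ →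
      (∀ z : V, (∃ e ∈ E₁, z ∈ e) → (∃ e ∈ E₂, z ∈ e) → z = x ∨ z = y) →
      E ⊆ E₁ ∪ E₂ → C ⊆ E₁ ∪ E₂ →
      (∃ e ∈ E₁, b ∈ e) → (∃ e ∈ E₁, s ∈ e) → (∃ e ∈ E₁, t ∈ e) →
      b ≠ x → b ≠ y → s ≠ x → s ≠ y → t ≠ x → t ≠ y → b ≠ s → b ≠ t → s ≠ t → SPGoodC E C b s t)
    (hTri3 : ∀ {Qac Qad Qbc Qbd Qcd E₂ E C : Finset (Sym2 V)} {x y c d b s t : V},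
      IsKNet Qac x c → IsKNet Qad x d → IsKNet Qbc y c → IsKNet Qbd y d → IsKNet Qcd c d → BridgeSep Qac Qad Qbc Qbd Qcd x y c d →
      IsKNet E₂ x y → Disjoint (Qac ∪ Qad ∪ Qbc ∪ Qbd ∪ Qcd) E₂ → Qac ∪ Qad ∪ Qbc ∪ Qbd ∪ Qcd ∪ E₂ ⊆ N₀ →
      (∀ z : V, (∃ e ∈ Qac ∪ Qad ∪ Qbc ∪ Qbd ∪ Qcd, z ∈ e) → (∃ e ∈ E₂, z ∈ e) → z = x ∨ z = y) →
      E ⊆ Qac ∪ Qad ∪ Qbc ∪ Qbd ∪ Qcd ∪ E₂ → C ⊆ Qac ∪ Qad ∪ Qbc ∪ Qbd ∪ Qcd ∪ E₂ →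
      (∃ e ∈ Qcd, b ∈ e) → b ≠ c → b ≠ d → (∃ e ∈ Qac, s ∈ e) → s ≠ x → s ≠ c → (∃ e ∈ Qad, t ∈ e) → t ≠ x → t ≠ d → SPGoodC E C b s t)
    (hClaw3 : ∀ {Qac Qad Qbc Qbd Qcd E₂ E C : Finset (Sym2 V)} {x y c d b s t : V},
      IsKNet Qac x c → IsKNet Qad x d → IsKNet Qbc y c → IsKNet Qbd y d → IsKNet Qcd c d → BridgeSep Qac Qad Qbc Qbd Qcd x y c d →
      IsKNet E₂ x y → Disjoint (Qac ∪ Qad ∪ Qbc ∪ Qbd ∪ Qcd) E₂ → Qac ∪ Qad ∪ Qbc ∪ Qbd ∪ Qcd ∪ E₂ ⊆ N₀ →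
      (∀ z : V, (∃ e ∈ Qac ∪ Qad ∪ Qbc ∪ Qbd ∪ Qcd, z ∈ e) → (∃ e ∈ E₂, z ∈ e) → z = x ∨ z = y) →
      E ⊆ Qac ∪ Qad ∪ Qbc ∪ Qbd ∪ Qcd ∪ E₂ → C ⊆ Qac ∪ Qad ∪ Qbc ∪ Qbd ∪ Qcd ∪ E₂ →
      (∃ e ∈ Qcd, b ∈ e) → b ≠ c → b ≠ d → (∃ e ∈ Qac, s ∈ e) → s ≠ x → s ≠ c → (∃ e ∈ Qbc, t ∈ e) → t ≠ y → t ≠ c → SPGoodC E C b s t)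
    (hPathB : ∀ {Qac Qad Qbc Qbd Qcd E₂ E C : Finset (Sym2 V)} {x y c d b s t : V},
      IsKNet Qac x c → IsKNet Qad x d → IsKNet Qbc y c → IsKNet Qbd y d → IsKNet Qcd c d → BridgeSep Qac Qad Qbc Qbd Qcd x y c d →
      IsKNet E₂ x y → Disjoint (Qac ∪ Qad ∪ Qbc ∪ Qbd ∪ Qcd) E₂ → Qac ∪ Qad ∪ Qbc ∪ Qbd ∪ Qcd ∪ E₂ ⊆ N₀ →
      (∀ z : V, (∃ e ∈ Qac ∪ Qad ∪ Qbc ∪ Qbd ∪ Qcd, z ∈ e) → (∃ e ∈ E₂, z ∈ e) → z = x ∨ z = y) →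
      E ⊆ Qac ∪ Qad ∪ Qbc ∪ Qbd ∪ Qcd ∪ E₂ → C ⊆ Qac ∪ Qad ∪ Qbc ∪ Qbd ∪ Qcd ∪ E₂ →
      (∃ e ∈ Qcd, b ∈ e) → b ≠ c → b ≠ d → (∃ e ∈ Qac, s ∈ e) → s ≠ x → s ≠ c → (∃ e ∈ Qbd, t ∈ e) → t ≠ y → t ≠ d → SPGoodC E C b s t)
    (hac : IsKNet Qac x c) (had : IsKNet Qad x d) (hbc : IsKNet Qbc y c) (hbd : IsKNet Qbd y d) (hcd : IsKNet Qcd c d)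
    (hsep : BridgeSep Qac Qad Qbc Qbd Qcd x y c d) (h₂ : IsKNet E₂ x y) (hd : Disjoint (Qac ∪ Qad ∪ Qbc ∪ Qbd ∪ Qcd) E₂) (hN : Qac ∪ Qad ∪ Qbc ∪ Qbd ∪ Qcd ∪ E₂ ⊆ N₀)
    (hV : ∀ z : V, (∃ e ∈ Qac ∪ Qad ∪ Qbc ∪ Qbd ∪ Qcd, z ∈ e) → (∃ e ∈ E₂, z ∈ e) → z = x ∨ z = y)
    (hE : E ⊆ Qac ∪ Qad ∪ Qbc ∪ Qbd ∪ Qcd ∪ E₂) (hC : C ⊆ Qac ∪ Qad ∪ Qbc ∪ Qbd ∪ Qcd ∪ E₂) (hcard : (Qac ∪ Qad ∪ Qbc ∪ Qbd ∪ Qcd).card ≤ n + 1)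
    (hb : ∃ e ∈ Qcd, b ∈ e) (hbx : b ≠ x) (hby : b ≠ y) (hbc' : b ≠ c) (hbd' : b ≠ d)
    (hs : ∃ e ∈ Qac ∪ Qad ∪ Qbc ∪ Qbd ∪ Qcd, s ∈ e) (ht : ∃ e ∈ Qac ∪ Qad ∪ Qbc ∪ Qbd ∪ Qcd, t ∈ e)
    (hsx : s ≠ x) (hsy : s ≠ y) (hsc : s ≠ c) (hsd : s ≠ d) (htx : t ≠ x) (hty : t ≠ y) (htc : t ≠ c) (htd : t ≠ d)
    (hbs : b ≠ s) (hbt : b ≠ t) (hst : s ≠ t) : SPGoodC E C b s t := by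
  obtain ⟨es, hes, hses⟩ := hs
  obtain ⟨et, het, htet⟩ := ht
  simp only [Finset.mem_union] at hes het
  rcases hes with (((hes | hes) | hes) | hes) | hes
  · -- s ∈ Qac
    have hs : ∃ e ∈ Qac, s ∈ e := ⟨es, hes, hses⟩
    rcases het with (((het | het) | het) | het) | het
    · have ht : ∃ e ∈ Qac, t ∈ e := ⟨et, het, htet⟩
      exact pcK_bridge_slot2_ac hTypeI hac had hbc hbd hcd hsep h₂ hd hN hV hE hC hs ht (let ⟨g, hg, hmg⟩ := hb; ⟨g, (fun h => Finset.mem_union_left _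
          (Finset.mem_union_right _ h)) hg, hmg⟩) hsx hsc htx htc hbx hbc' hst
    · have ht : ∃ e ∈ Qad, t ∈ e := ⟨et, het, htet⟩
      exact (hTri3 hac had hbc hbd hcd hsep h₂ hd hN hV hE hC hb hbc' hbd' hs hsx hsc ht htx htd)
    · have ht : ∃ e ∈ Qbc, t ∈ e := ⟨et, het, htet⟩
      exact (hClaw3 hac had hbc hbd hcd hsep h₂ hd hN hV hE hC hb hbc' hbd' hs hsx hsc ht hty htc)
    · have ht : ∃ e ∈ Qbd, t ∈ e := ⟨et, het, htet⟩
      exact (hPathB hac had hbc hbd hcd hsep h₂ hd hN hV hE hC hb hbc' hbd' hs hsx hsc ht hty htd)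
    · have ht : ∃ e ∈ Qcd, t ∈ e := ⟨et, het, htet⟩
      exact (pcK_bridge_slot2_cd hTypeI hac had hbc hbd hcd hsep h₂ hd hN hV hE hC hb ht (let ⟨g, hg, hmg⟩ := hs; ⟨g, (fun h => Finset.mem_union_left _
          (Finset.mem_union_left _ (Finset.mem_union_left _ (Finset.mem_union_left _ (h))))) hg, hmg⟩) hbc' hbd' htc htd hsc hsd hbt).swap12
  · -- s ∈ Qad
    have hs : ∃ e ∈ Qad, s ∈ e := ⟨es, hes, hses⟩
    rcases het with (((het | het) | het) | het) | het
    · have ht : ∃ e ∈ Qac, t ∈ e := ⟨et, het, htet⟩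
      exact (hTri3 hac had hbc hbd hcd hsep h₂ hd hN hV hE hC hb hbc' hbd' ht htx htc hs hsx hsd).swap23
    · have ht : ∃ e ∈ Qad, t ∈ e := ⟨et, het, htet⟩
      rw [show Qac ∪ Qad ∪ Qbc ∪ Qbd ∪ Qcd = Qad ∪ Qac ∪ Qbd ∪ Qbc ∪ Qcd from by ac_rfl] at hd hN hV hE hC hcard
      exact pcK_bridge_slot2_ac hTypeI had hac hbd hbc hcd.symm hsep.swap_cd h₂ hd hN hV hE hC hs ht (let ⟨g, hg, hmg⟩ := hb; ⟨g, (fun h =>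
          Finset.mem_union_left _ (Finset.mem_union_right _ h)) hg, hmg⟩) hsx hsd htx htd hbx hbd' hst
    · have ht : ∃ e ∈ Qbc, t ∈ e := ⟨et, het, htet⟩
      rw [show Qac ∪ Qad ∪ Qbc ∪ Qbd ∪ Qcd = Qad ∪ Qac ∪ Qbd ∪ Qbc ∪ Qcd from by ac_rfl] at hd hN hV hE hC hcard
      exact (hPathB had hac hbd hbc hcd.symm hsep.swap_cd h₂ hd hN hV hE hC hb hbd' hbc' hs hsx hsd ht hty htc)
    · have ht : ∃ e ∈ Qbd, t ∈ e := ⟨et, het, htet⟩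
      rw [show Qac ∪ Qad ∪ Qbc ∪ Qbd ∪ Qcd = Qad ∪ Qac ∪ Qbd ∪ Qbc ∪ Qcd from by ac_rfl] at hd hN hV hE hC hcard
      exact (hClaw3 had hac hbd hbc hcd.symm hsep.swap_cd h₂ hd hN hV hE hC hb hbd' hbc' hs hsx hsd ht hty htd)
    · have ht : ∃ e ∈ Qcd, t ∈ e := ⟨et, het, htet⟩
      exact (pcK_bridge_slot2_cd hTypeI hac had hbc hbd hcd hsep h₂ hd hN hV hE hC hb ht (let ⟨g, hg, hmg⟩ := hs; ⟨g, (fun h => Finset.mem_union_left _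
          (Finset.mem_union_left _ (Finset.mem_union_right _ h))) hg, hmg⟩) hbc' hbd' htc htd hsc hsd hbt).swap12
  · -- s ∈ Qbc
    have hs : ∃ e ∈ Qbc, s ∈ e := ⟨es, hes, hses⟩
    rcases het with (((het | het) | het) | het) | het
    · have ht : ∃ e ∈ Qac, t ∈ e := ⟨et, het, htet⟩
      exact (hClaw3 hac had hbc hbd hcd hsep h₂ hd hN hV hE hC hb hbc' hbd' ht htx htc hs hsy hsc).swap23
    · have ht : ∃ e ∈ Qad, t ∈ e := ⟨et, het, htet⟩
      rw [show Qac ∪ Qad ∪ Qbc ∪ Qbd ∪ Qcd = Qad ∪ Qac ∪ Qbd ∪ Qbc ∪ Qcd from by ac_rfl] at hd hN hV hE hC hcard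
      exact (hPathB had hac hbd hbc hcd.symm hsep.swap_cd h₂ hd hN hV hE hC hb hbd' hbc' ht htx htd hs hsy hsc).swap23
    · have ht : ∃ e ∈ Qbc, t ∈ e := ⟨et, het, htet⟩
      rw [show Qac ∪ Qad ∪ Qbc ∪ Qbd ∪ Qcd = Qbc ∪ Qbd ∪ Qac ∪ Qad ∪ Qcd from by ac_rfl] at hd hN hV hE hC hcard
      exact pcK_bridge_slot2_ac hTypeI hbc hbd hac had hcd hsep.symm h₂.symm hd hN (fun z h1 h2 => (hV z h1 h2).symm) hE hC hs ht (let ⟨g, hg, hmg⟩ := hb; ⟨g,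
          (fun h => Finset.mem_union_left _ (Finset.mem_union_right _ h)) hg, hmg⟩) hsy hsc hty htc hby hbc' hst
    · have ht : ∃ e ∈ Qbd, t ∈ e := ⟨et, het, htet⟩
      rw [show Qac ∪ Qad ∪ Qbc ∪ Qbd ∪ Qcd = Qbc ∪ Qbd ∪ Qac ∪ Qad ∪ Qcd from by ac_rfl] at hd hN hV hE hC hcard
      exact (hTri3 hbc hbd hac had hcd hsep.symm h₂.symm hd hN (fun z h1 h2 => (hV z h1 h2).symm) hE hC hb hbc' hbd' hs hsy hsc ht hty htd)
    · have ht : ∃ e ∈ Qcd, t ∈ e := ⟨et, het, htet⟩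
      exact (pcK_bridge_slot2_cd hTypeI hac had hbc hbd hcd hsep h₂ hd hN hV hE hC hb ht (let ⟨g, hg, hmg⟩ := hs; ⟨g, (fun h => Finset.mem_union_left _
          (Finset.mem_union_left _ (Finset.mem_union_left _ (Finset.mem_union_right _ h)))) hg, hmg⟩) hbc' hbd' htc htd hsc hsd hbt).swap12
  · -- s ∈ Qbd
    have hs : ∃ e ∈ Qbd, s ∈ e := ⟨es, hes, hses⟩
    rcases het with (((het | het) | het) | het) | het
    · have ht : ∃ e ∈ Qac, t ∈ e := ⟨et, het, htet⟩
      exact (hPathB hac had hbc hbd hcd hsep h₂ hd hN hV hE hC hb hbc' hbd' ht htx htc hs hsy hsd).swap23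
    · have ht : ∃ e ∈ Qad, t ∈ e := ⟨et, het, htet⟩
      rw [show Qac ∪ Qad ∪ Qbc ∪ Qbd ∪ Qcd = Qad ∪ Qac ∪ Qbd ∪ Qbc ∪ Qcd from by ac_rfl] at hd hN hV hE hC hcard
      exact (hClaw3 had hac hbd hbc hcd.symm hsep.swap_cd h₂ hd hN hV hE hC hb hbd' hbc' ht htx htd hs hsy hsd).swap23
    · have ht : ∃ e ∈ Qbc, t ∈ e := ⟨et, het, htet⟩
      rw [show Qac ∪ Qad ∪ Qbc ∪ Qbd ∪ Qcd = Qbc ∪ Qbd ∪ Qac ∪ Qad ∪ Qcd from by ac_rfl] at hd hN hV hE hC hcard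
      exact (hTri3 hbc hbd hac had hcd hsep.symm h₂.symm hd hN (fun z h1 h2 => (hV z h1 h2).symm) hE hC hb hbc' hbd' ht hty htc hs hsy hsd).swap23
    · have ht : ∃ e ∈ Qbd, t ∈ e := ⟨et, het, htet⟩
      rw [show Qac ∪ Qad ∪ Qbc ∪ Qbd ∪ Qcd = Qbd ∪ Qbc ∪ Qad ∪ Qac ∪ Qcd from by ac_rfl] at hd hN hV hE hC hcard
      exact pcK_bridge_slot2_ac hTypeI hbd hbc had hac hcd.symm hsep.symm.swap_cd h₂.symm hd hN (fun z h1 h2 => (hV z h1 h2).symm) hE hC hs ht (let ⟨g, hg,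
          hmg⟩ := hb; ⟨g, (fun h => Finset.mem_union_left _ (Finset.mem_union_right _ h)) hg, hmg⟩) hsy hsd hty htd hby hbd' hst
    · have ht : ∃ e ∈ Qcd, t ∈ e := ⟨et, het, htet⟩
      exact (pcK_bridge_slot2_cd hTypeI hac had hbc hbd hcd hsep h₂ hd hN hV hE hC hb ht (let ⟨g, hg, hmg⟩ := hs; ⟨g, (fun h => Finset.mem_union_left _
          (Finset.mem_union_right _ h)) hg, hmg⟩) hbc' hbd' htc htd hsc hsd hbt).swap12
  · -- s ∈ Qcd
    have hs : ∃ e ∈ Qcd, s ∈ e := ⟨es, hes, hses⟩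
    rcases het with (((het | het) | het) | het) | het
    · have ht : ∃ e ∈ Qac, t ∈ e := ⟨et, het, htet⟩
      exact (pcK_bridge_slot2_cd hTypeI hac had hbc hbd hcd hsep h₂ hd hN hV hE hC hb hs (let ⟨g, hg, hmg⟩ := ht; ⟨g, (fun h => Finset.mem_union_left _
          (Finset.mem_union_left _ (Finset.mem_union_left _ (Finset.mem_union_left _ (h))))) hg, hmg⟩) hbc' hbd' hsc hsd htc htd hbs).rotate
    · have ht : ∃ e ∈ Qad, t ∈ e := ⟨et, het, htet⟩
      exact (pcK_bridge_slot2_cd hTypeI hac had hbc hbd hcd hsep h₂ hd hN hV hE hC hb hs (let ⟨g, hg, hmg⟩ := ht; ⟨g, (fun h => Finset.mem_union_left _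
          (Finset.mem_union_left _ (Finset.mem_union_right _ h))) hg, hmg⟩) hbc' hbd' hsc hsd htc htd hbs).rotate
    · have ht : ∃ e ∈ Qbc, t ∈ e := ⟨et, het, htet⟩
      exact (pcK_bridge_slot2_cd hTypeI hac had hbc hbd hcd hsep h₂ hd hN hV hE hC hb hs (let ⟨g, hg, hmg⟩ := ht; ⟨g, (fun h => Finset.mem_union_left _
          (Finset.mem_union_left _ (Finset.mem_union_left _ (Finset.mem_union_right _ h)))) hg, hmg⟩) hbc' hbd' hsc hsd htc htd hbs).rotate
    · have ht : ∃ e ∈ Qbd, t ∈ e := ⟨et, het, htet⟩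
      exact (pcK_bridge_slot2_cd hTypeI hac had hbc hbd hcd hsep h₂ hd hN hV hE hC hb hs (let ⟨g, hg, hmg⟩ := ht; ⟨g, (fun h => Finset.mem_union_left _
          (Finset.mem_union_right _ h)) hg, hmg⟩) hbc' hbd' hsc hsd htc htd hbs).rotate
    · have ht : ∃ e ∈ Qcd, t ∈ e := ⟨et, het, htet⟩
      exact pcK_bridge_slot3_cd ih hac had hbc hbd hcd hsep h₂ hd hN hV hE hC hcard hb hs ht hbc' hbd' hsc hsd htc htd hbs hbt hst

/-- **THE `pc` BRIDGE BRANCH, modulo the five K-state leaves**: the `| bridge` alternative of `FK.pcK_good` (census g41 drafts). [cite: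
    AyyerLinussonRavichandran2025, §7 (p. 22)] -/
theorem pcK_bridge_dispatch
    (hTypeI : ∀ {E₁ E₂ E C : Finset (Sym2 V)} {x y b s t : V},
      IsKNet E₁ x y → IsKNet E₂ x y → Disjoint E₁ E₂ → E₁ ∪ E₂ ⊆ N₀ →
      (∀ z : V, (∃ e ∈ E₁, z ∈ e) → (∃ e ∈ E₂, z ∈ e) → z = x ∨ z = y) →
      E ⊆ E₁ ∪ E₂ → C ⊆ E₁ ∪ E₂ →
      (∃ e ∈ E₁, s ∈ e) → (∃ e ∈ E₁, t ∈ e) → (∃ e ∈ E₂, b ∈ e) →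
      s ≠ x → s ≠ y → t ≠ x → t ≠ y → b ≠ x → b ≠ y → s ≠ t → SPGoodC E C b s t)
    (hPb : ∀ {E₁ E₂ E C : Finset (Sym2 V)} {x y s t : V},
      IsKNet E₁ x y → IsKNet E₂ x y → Disjoint E₁ E₂ → E₁ ∪ E₂ ⊆ N₀ →
      (∀ z : V, (∃ e ∈ E₁, z ∈ e) → (∃ e ∈ E₂, z ∈ e) → z = x ∨ z = y) →
      E ⊆ E₁ ∪ E₂ → C ⊆ E₁ ∪ E₂ →
      (∃ e ∈ E₁, s ∈ e) → (∃ e ∈ E₁, t ∈ e) →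
      s ≠ x → s ≠ y → t ≠ x → t ≠ y → s ≠ t → SPGoodC E C x s t)
    (ih : ∀ {E₁ E₂ E C : Finset (Sym2 V)} {x y b s t : V}, E₁.card ≤ n →
      IsKNet E₁ x y → IsKNet E₂ x y → Disjoint E₁ E₂ → E₁ ∪ E₂ ⊆ N₀ →
      (∀ z : V, (∃ e ∈ E₁, z ∈ e) → (∃ e ∈ E₂, z ∈ e) → z = x ∨ z = y) →
      E ⊆ E₁ ∪ E₂ → C ⊆ E₁ ∪ E₂ →
      (∃ e ∈ E₁, b ∈ e) → (∃ e ∈ E₁, s ∈ e) → (∃ e ∈ E₁, t ∈ e) →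
      b ≠ x → b ≠ y → s ≠ x → s ≠ y → t ≠ x → t ≠ y → b ≠ s → b ≠ t → s ≠ t → SPGoodC E C b s t)
    (hTri3 : ∀ {Qac Qad Qbc Qbd Qcd E₂ E C : Finset (Sym2 V)} {x y c d b s t : V},
      IsKNet Qac x c → IsKNet Qad x d → IsKNet Qbc y c → IsKNet Qbd y d → IsKNet Qcd c d → BridgeSep Qac Qad Qbc Qbd Qcd x y c d →
      IsKNet E₂ x y → Disjoint (Qac ∪ Qad ∪ Qbc ∪ Qbd ∪ Qcd) E₂ → Qac ∪ Qad ∪ Qbc ∪ Qbd ∪ Qcd ∪ E₂ ⊆ N₀ →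
      (∀ z : V, (∃ e ∈ Qac ∪ Qad ∪ Qbc ∪ Qbd ∪ Qcd, z ∈ e) → (∃ e ∈ E₂, z ∈ e) → z = x ∨ z = y) →
      E ⊆ Qac ∪ Qad ∪ Qbc ∪ Qbd ∪ Qcd ∪ E₂ → C ⊆ Qac ∪ Qad ∪ Qbc ∪ Qbd ∪ Qcd ∪ E₂ →
      (∃ e ∈ Qcd, b ∈ e) → b ≠ c → b ≠ d → (∃ e ∈ Qac, s ∈ e) → s ≠ x → s ≠ c → (∃ e ∈ Qad, t ∈ e) → t ≠ x → t ≠ d → SPGoodC E C b s t)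
    (hClaw3 : ∀ {Qac Qad Qbc Qbd Qcd E₂ E C : Finset (Sym2 V)} {x y c d b s t : V},
      IsKNet Qac x c → IsKNet Qad x d → IsKNet Qbc y c → IsKNet Qbd y d → IsKNet Qcd c d → BridgeSep Qac Qad Qbc Qbd Qcd x y c d →
      IsKNet E₂ x y → Disjoint (Qac ∪ Qad ∪ Qbc ∪ Qbd ∪ Qcd) E₂ → Qac ∪ Qad ∪ Qbc ∪ Qbd ∪ Qcd ∪ E₂ ⊆ N₀ →
      (∀ z : V, (∃ e ∈ Qac ∪ Qad ∪ Qbc ∪ Qbd ∪ Qcd, z ∈ e) → (∃ e ∈ E₂, z ∈ e) → z = x ∨ z = y) →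
      E ⊆ Qac ∪ Qad ∪ Qbc ∪ Qbd ∪ Qcd ∪ E₂ → C ⊆ Qac ∪ Qad ∪ Qbc ∪ Qbd ∪ Qcd ∪ E₂ →
      (∃ e ∈ Qcd, b ∈ e) → b ≠ c → b ≠ d → (∃ e ∈ Qac, s ∈ e) → s ≠ x → s ≠ c → (∃ e ∈ Qbc, t ∈ e) → t ≠ y → t ≠ c → SPGoodC E C b s t)
    (hPathA : ∀ {Qac Qad Qbc Qbd Qcd E₂ E C : Finset (Sym2 V)} {x y c d b s t : V},
      IsKNet Qac x c → IsKNet Qad x d → IsKNet Qbc y c → IsKNet Qbd y d → IsKNet Qcd c d → BridgeSep Qac Qad Qbc Qbd Qcd x y c d →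
      IsKNet E₂ x y → Disjoint (Qac ∪ Qad ∪ Qbc ∪ Qbd ∪ Qcd) E₂ → Qac ∪ Qad ∪ Qbc ∪ Qbd ∪ Qcd ∪ E₂ ⊆ N₀ →
      (∀ z : V, (∃ e ∈ Qac ∪ Qad ∪ Qbc ∪ Qbd ∪ Qcd, z ∈ e) → (∃ e ∈ E₂, z ∈ e) → z = x ∨ z = y) →
      E ⊆ Qac ∪ Qad ∪ Qbc ∪ Qbd ∪ Qcd ∪ E₂ → C ⊆ Qac ∪ Qad ∪ Qbc ∪ Qbd ∪ Qcd ∪ E₂ →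
      (∃ e ∈ Qac, b ∈ e) → b ≠ x → b ≠ c → (∃ e ∈ Qad, s ∈ e) → s ≠ x → s ≠ d → (∃ e ∈ Qbc, t ∈ e) → t ≠ y → t ≠ c → SPGoodC E C b s t)
    (hPathB : ∀ {Qac Qad Qbc Qbd Qcd E₂ E C : Finset (Sym2 V)} {x y c d b s t : V},
      IsKNet Qac x c → IsKNet Qad x d → IsKNet Qbc y c → IsKNet Qbd y d → IsKNet Qcd c d → BridgeSep Qac Qad Qbc Qbd Qcd x y c d →
      IsKNet E₂ x y → Disjoint (Qac ∪ Qad ∪ Qbc ∪ Qbd ∪ Qcd) E₂ → Qac ∪ Qad ∪ Qbc ∪ Qbd ∪ Qcd ∪ E₂ ⊆ N₀ →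
      (∀ z : V, (∃ e ∈ Qac ∪ Qad ∪ Qbc ∪ Qbd ∪ Qcd, z ∈ e) → (∃ e ∈ E₂, z ∈ e) → z = x ∨ z = y) →
      E ⊆ Qac ∪ Qad ∪ Qbc ∪ Qbd ∪ Qcd ∪ E₂ → C ⊆ Qac ∪ Qad ∪ Qbc ∪ Qbd ∪ Qcd ∪ E₂ →
      (∃ e ∈ Qcd, b ∈ e) → b ≠ c → b ≠ d → (∃ e ∈ Qac, s ∈ e) → s ≠ x → s ≠ c → (∃ e ∈ Qbd, t ∈ e) → t ≠ y → t ≠ d → SPGoodC E C b s t)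
    (hVee3 : ∀ {Qac Qad Qbc Qbd Qcd E₂ E C : Finset (Sym2 V)} {x y c d s t : V},
      IsKNet Qac x c → IsKNet Qad x d → IsKNet Qbc y c → IsKNet Qbd y d → IsKNet Qcd c d → BridgeSep Qac Qad Qbc Qbd Qcd x y c d →
      IsKNet E₂ x y → Disjoint (Qac ∪ Qad ∪ Qbc ∪ Qbd ∪ Qcd) E₂ → Qac ∪ Qad ∪ Qbc ∪ Qbd ∪ Qcd ∪ E₂ ⊆ N₀ →
      (∀ z : V, (∃ e ∈ Qac ∪ Qad ∪ Qbc ∪ Qbd ∪ Qcd, z ∈ e) → (∃ e ∈ E₂, z ∈ e) → z = x ∨ z = y) →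
      E ⊆ Qac ∪ Qad ∪ Qbc ∪ Qbd ∪ Qcd ∪ E₂ → C ⊆ Qac ∪ Qad ∪ Qbc ∪ Qbd ∪ Qcd ∪ E₂ →
      (∃ e ∈ Qad, s ∈ e) → s ≠ x → s ≠ d → (∃ e ∈ Qbd, t ∈ e) → t ≠ y → t ≠ d → SPGoodC E C c s t)
    (hac : IsKNet Qac x c) (had : IsKNet Qad x d) (hbc : IsKNet Qbc y c) (hbd : IsKNet Qbd y d) (hcd : IsKNet Qcd c d)
    (hsep : BridgeSep Qac Qad Qbc Qbd Qcd x y c d) (h₂ : IsKNet E₂ x y) (hd : Disjoint (Qac ∪ Qad ∪ Qbc ∪ Qbd ∪ Qcd) E₂) (hN : Qac ∪ Qad ∪ Qbc ∪ Qbd ∪ Qcd ∪ E₂ ⊆ N₀)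
    (hV : ∀ z : V, (∃ e ∈ Qac ∪ Qad ∪ Qbc ∪ Qbd ∪ Qcd, z ∈ e) → (∃ e ∈ E₂, z ∈ e) → z = x ∨ z = y)
    (hE : E ⊆ Qac ∪ Qad ∪ Qbc ∪ Qbd ∪ Qcd ∪ E₂) (hC : C ⊆ Qac ∪ Qad ∪ Qbc ∪ Qbd ∪ Qcd ∪ E₂) (hcard : (Qac ∪ Qad ∪ Qbc ∪ Qbd ∪ Qcd).card ≤ n + 1)
    (hb : ∃ e ∈ Qac ∪ Qad ∪ Qbc ∪ Qbd ∪ Qcd, b ∈ e) (hs : ∃ e ∈ Qac ∪ Qad ∪ Qbc ∪ Qbd ∪ Qcd, s ∈ e) (ht : ∃ e ∈ Qac ∪ Qad ∪ Qbc ∪ Qbd ∪ Qcd, t ∈ e)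
    (hbx : b ≠ x) (hby : b ≠ y) (hsx : s ≠ x) (hsy : s ≠ y) (htx : t ≠ x) (hty : t ≠ y) (hbs : b ≠ s) (hbt : b ≠ t) (hst : s ≠ t) :
    SPGoodC E C b s t := by
  -- two corner marks ⇒ THEOREM 𝒯₂(𝒦) at the view `cd`; one corner mark ⇒ `pcK_bridge_b_at_c` (after a symmetry); none ⇒ by the slot of `b`
  by_cases hbc' : b = c
  · subst hbc'
    by_cases hsd : s = d
    · subst hsd
      exact pcK_bridge_two_corners hac had hbc hbd hcd hsep h₂ hd hV hE hC (let ⟨g, hg, hmg⟩ := ht; ⟨g, Finset.mem_union_left _ hg, hmg⟩) (Ne.symm hbt)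
          (Ne.symm hst)
    by_cases htd : t = d
    · subst htd
      exact (pcK_bridge_two_corners hac had hbc hbd hcd hsep h₂ hd hV hE hC (let ⟨g, hg, hmg⟩ := hs; ⟨g, Finset.mem_union_left _ hg, hmg⟩) (Ne.symm hbs)
          hst).swap23
    exact pcK_bridge_b_at_c hTypeI hPb hVee3 hac had hbc hbd hcd hsep h₂ hd hN hV hE hC hs ht hsx hsy (Ne.symm hbs) hsd htx hty (Ne.symm hbt) htd hst
  by_cases hbd' : b = d
  · subst hbd'
    by_cases hsc : s = c
    · subst hsc
      exact (pcK_bridge_two_corners hac had hbc hbd hcd hsep h₂ hd hV hE hC (let ⟨g, hg, hmg⟩ := ht; ⟨g, Finset.mem_union_left _ hg, hmg⟩) (Ne.symm hst)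
          (Ne.symm hbt)).swap12
    by_cases htc : t = c
    · subst htc
      exact (pcK_bridge_two_corners hac had hbc hbd hcd hsep h₂ hd hV hE hC (let ⟨g, hg, hmg⟩ := hs; ⟨g, Finset.mem_union_left _ hg, hmg⟩) hst (Ne.symm
          hbs)).rotate
    rw [show Qac ∪ Qad ∪ Qbc ∪ Qbd ∪ Qcd = Qad ∪ Qac ∪ Qbd ∪ Qbc ∪ Qcd from by ac_rfl] at hd hN hV hE hC hs ht
    exact pcK_bridge_b_at_c hTypeI hPb hVee3 had hac hbd hbc hcd.symm hsep.swap_cd h₂ hd hN hV hE hC hs ht hsx hsy (Ne.symm hbs) hsc htx hty (Ne.symm hbt)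
        htc hst
  by_cases hsc : s = c
  · subst hsc
    by_cases htd : t = d
    · subst htd
      exact (pcK_bridge_two_corners hac had hbc hbd hcd hsep h₂ hd hV hE hC (let ⟨g, hg, hmg⟩ := hb; ⟨g, Finset.mem_union_left _ hg, hmg⟩) hbc'
          hbd').rotate'
    exact (pcK_bridge_b_at_c hTypeI hPb hVee3 hac had hbc hbd hcd hsep h₂ hd hN hV hE hC hb ht hbx hby hbc' hbd' htx hty (Ne.symm hst) htd hbt).swap12
  by_cases hsd : s = d
  · subst hsd
    by_cases htc : t = c
    · subst htc
      exact (pcK_bridge_two_corners hac had hbc hbd hcd hsep h₂ hd hV hE hC (let ⟨g, hg, hmg⟩ := hb; ⟨g, Finset.mem_union_left _ hg, hmg⟩) hbc' hbd').swap13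
    rw [show Qac ∪ Qad ∪ Qbc ∪ Qbd ∪ Qcd = Qad ∪ Qac ∪ Qbd ∪ Qbc ∪ Qcd from by ac_rfl] at hd hN hV hE hC hb ht
    exact (pcK_bridge_b_at_c hTypeI hPb hVee3 had hac hbd hbc hcd.symm hsep.swap_cd h₂ hd hN hV hE hC hb ht hbx hby hbd' hbc' htx hty (Ne.symm hst) htc
        hbt).swap12
  by_cases htc : t = c
  · subst htc
    exact (pcK_bridge_b_at_c hTypeI hPb hVee3 hac had hbc hbd hcd hsep h₂ hd hN hV hE hC hb hs hbx hby hbc' hbd' hsx hsy hsc hsd hbs).rotate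
  by_cases htd : t = d
  · subst htd
    rw [show Qac ∪ Qad ∪ Qbc ∪ Qbd ∪ Qcd = Qad ∪ Qac ∪ Qbd ∪ Qbc ∪ Qcd from by ac_rfl] at hd hN hV hE hC hb hs
    exact (pcK_bridge_b_at_c hTypeI hPb hVee3 had hac hbd hbc hcd.symm hsep.swap_cd h₂ hd hN hV hE hC hb hs hbx hby hbd' hbc' hsx hsy hsd hsc hbs).rotate
  -- no corner mark: by the slot of `b`
  obtain ⟨eb, heb, hbeb⟩ := hb
  simp only [Finset.mem_union] at heb
  rcases heb with (((heb | heb) | heb) | heb) | heb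
  · -- b ∈ Qac
    exact pcK_bridge_b_in_ac hTypeI ih hTri3 hClaw3 hPathA hPathB hac had hbc hbd hcd hsep h₂ hd hN hV hE hC hcard ⟨eb, heb, hbeb⟩ hbx hby hbc' hbd' hs ht
        hsx hsy hsc hsd htx hty htc htd hbs hbt hst
  · -- b ∈ Qad
    rw [show Qac ∪ Qad ∪ Qbc ∪ Qbd ∪ Qcd = Qad ∪ Qac ∪ Qbd ∪ Qbc ∪ Qcd from by ac_rfl] at hd hN hV hE hC hcard hs ht
    exact pcK_bridge_b_in_ac hTypeI ih hTri3 hClaw3 hPathA hPathB had hac hbd hbc hcd.symm hsep.swap_cd h₂ hd hN hV hE hC hcard ⟨eb, heb, hbeb⟩ hbx hby hbd'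
        hbc' hs ht hsx hsy hsd hsc htx hty htd htc hbs hbt hst
  · -- b ∈ Qbc
    rw [show Qac ∪ Qad ∪ Qbc ∪ Qbd ∪ Qcd = Qbc ∪ Qbd ∪ Qac ∪ Qad ∪ Qcd from by ac_rfl] at hd hN hV hE hC hcard hs ht
    exact pcK_bridge_b_in_ac hTypeI ih hTri3 hClaw3 hPathA hPathB hbc hbd hac had hcd hsep.symm h₂.symm hd hN (fun z h1 h2 => (hV z h1 h2).symm) hE hC hcard
        ⟨eb, heb, hbeb⟩ hby hbx hbc' hbd' hs ht hsy hsx hsc hsd hty htx htc htd hbs hbt hst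
  · -- b ∈ Qbd
    rw [show Qac ∪ Qad ∪ Qbc ∪ Qbd ∪ Qcd = Qbd ∪ Qbc ∪ Qad ∪ Qac ∪ Qcd from by ac_rfl] at hd hN hV hE hC hcard hs ht
    exact pcK_bridge_b_in_ac hTypeI ih hTri3 hClaw3 hPathA hPathB hbd hbc had hac hcd.symm hsep.symm.swap_cd h₂.symm hd hN (fun z h1 h2 => (hV z h1 h2).symm)
        hE hC hcard ⟨eb, heb, hbeb⟩ hby hbx hbd' hbc' hs ht hsy hsx hsd hsc hty htx htd htc hbs hbt hst
  · -- b ∈ Qcd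
    exact pcK_bridge_b_in_cd hTypeI ih hTri3 hClaw3 hPathB hac had hbc hbd hcd hsep h₂ hd hN hV hE hC hcard ⟨eb, heb, hbeb⟩ hbx hby hbc' hbd' hs ht hsx hsy
        hsc hsd htx hty htc htd hbs hbt hst

end PcDispatch

end FK

end Summit.CriticalPhenomena.PercolationContinuityZ3.Theorems
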